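import Summits.ResolutionOfSingularities.ResolutionOfSingularities.Theorems.EquisingularLiftEquisingularLiftNatCarrierDeltaStalks
import Literature.AlgebraicGeometry.Resolution.CanonicalResolutionSmoothCentre
import Literature.AlgebraicGeometry.Resolution.SymbolicPowersRsop
import Literature.AlgebraicGeometry.Resolution.AlterationsSectionDivisor
import Literature.AlgebraicGeometry.Resolution.NodalBlowupChartAlgebra
import HarnessLib

/-!
# [OURS · L1 W4.5(b)] T-CARRIER-Δ (4/4): the SECTION FRAME — the stalk-local data at `s(s₀)` consumed by
# `…CarrierDeltaStalks` / `…CarrierDeltaFlat` / `…CarrierDeltaRegular`, produced once from «`s` a section, `P` regular at `s(s₀)`»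

Support file of the crux chain w45b (cell `res-hironaka`, LADDER-RESOLUTION rung L, slot W4.5(b)), working crux
**EL♮ = `Theses.EquisingularLift.EquisingularLiftNat`** (stmt-ResolutionOfSingularities-20038), registered stub
`stub_elnat_tcDeltaPointResolution` (skeleton v5.1); target **T-CARRIER-Δ** of res-L1-w45b-lead-2, discharge of the
hypothesis pack HΔ(AdmTC) by res-D-pv-029's T-INST. OURS; NOT a statement of any manuscript; AI-written, weaker than
expert review. Filed `--supports stmt-ResolutionOfSingularities-20038 --as helper`.

The three T-CARRIER-Δ files (p509910, p512232, p513634) take, at the stalk `R = 𝒪_{P,s(s₀)}`, a sequence `c` with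
`(c) = (ker s)_{s(s₀)}`, `c` quasi-regular, `R/(c)` a domain, `(c) + (ϖ_R) = 𝔪_R`, `ϖ_R ∉ (c)` (`ϖ_R` the germ of
`q^*ϖ`), and an identification `θ : R/(c) ≅ Λ`. **`exists_sectionFrame`** produces ALL of these from: `O` a DVR with
uniformizer `ϖ`, `q : P → Spec O` separated, `s` a section (`s ≫ q = 𝟙`), and `𝒪_{P,s(s₀)}` a regular local ring
(e.g. `q` smooth, `stub_goodAtOfSmooth`) — with `Λ = O` and **`θ(ϖ̄_R) = ϖ`**, so that the Δ-criterion hypothesis of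
`isRegular_carrierDelta_subscheme` reads over `O[T₁, T₂]/(f)` at the primes containing `C ϖ`, the literal currency of D1
(iii) `deltaRegularGeneric` (p502482) and of res-type-032's Δ-criterion files (p512537).

* `exists_ringEquiv_stalk_closedPoint` — `O ≃+* 𝒪_{Spec O, s₀}` with its value on `O`;
* `stalkMap_section_Γgerm_appTop` — `s^♯(germ of q^* a) = germ of a`;
* **`exists_sectionFrame`**; rev 2 **`exists_sectionFrame_of_span_eq`** — the same conclusions for the consumer's OWN
  generators `c` of `(ker s)_{s(s₀)}` when `dim 𝒪_{P,s(s₀)} = n + 1` (so the cone form is written in given coordinates);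
  rev 3 `exists_sectionFrame_of_span_eq_forall` — `θ(germ of q^* b) = b` for ALL `b ∈ O`; rev 4 `exists_sectionFrame_forall`
  (the existential frame with the same `∀ b` clause).

References: Matsumura, *Commutative Ring Theory* (1986), Thms. 14.2, 16.2; Stacks Project 01J7. -/

set_option linter.dupNamespace false -- mandated namespace `Summit.<Summit>.<Problem>` of this single-conjunct summit
set_option linter.overlappingInstances false -- signatures carry `[IsDomain O] [IsDiscreteValuationRing O]`

noncomputable section

open CategoryTheory AlgebraicGeometry TopologicalSpace IsLocalRing Opposite
open Literature.AlgebraicGeometry.Resolution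
open Summit.ResolutionOfSingularities.ResolutionOfSingularities.Cruxes.EquisingularLift.StrataSplit

namespace Summit.ResolutionOfSingularities.ResolutionOfSingularities.Cruxes.EquisingularLiftNat.Sections

variable (O : Type) [CommRing O] [IsDomain O] [IsDiscreteValuationRing O]

/-- **`𝒪_{Spec O, s₀} ≅ O`** for a local ring `O`: the stalk at the closed point is the localisation at the maximal ideal
(Mathlib `StructureSheaf.IsLocalization.to_stalk`), i.e. at units; the isomorphism sends `a ∈ O` to the germ of `a`.
[cite: StacksProject, Tag 01J7] -/
theorem exists_ringEquiv_stalk_closedPoint :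
    ∃ eO : O ≃+* (Spec (.of O)).presheaf.stalk (IsLocalRing.closedPoint O),
      ∀ a : O, eO a = ((Spec (.of O)).presheaf.germ ⊤ (IsLocalRing.closedPoint O) trivial).hom
        ((Scheme.ΓSpecIso (.of O)).inv.hom a) := by
  letI := StructureSheaf.stalkAlgebra O (IsLocalRing.closedPoint O)
  haveI := StructureSheaf.IsLocalization.to_stalk O (IsLocalRing.closedPoint O)
  have H : (IsLocalRing.closedPoint O).asIdeal.primeCompl ≤ IsUnit.submonoid O := by
    intro x hx
    have hx' : x ∉ maximalIdeal O := hx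
    rwa [IsLocalRing.mem_maximalIdeal, mem_nonunits_iff, not_not] at hx'
  exact ⟨(IsLocalization.atUnits O (IsLocalRing.closedPoint O).asIdeal.primeCompl H :
    O ≃ₐ[O] (Spec.structureSheaf O).presheaf.stalk (IsLocalRing.closedPoint O)).toRingEquiv, fun a => rfl⟩

omit [IsDomain O] [IsDiscreteValuationRing O] in
/-- For a section `s` of `q` (`s ≫ q = 𝟙`): `s^♯` takes the germ at `s(y)` of `q^* a` to the germ at `y` of `a`.
[folklore] -/
theorem stalkMap_section_Γgerm_appTop {P : Scheme.{0}} (q : P ⟶ Spec (.of O)) (s : Spec (.of O) ⟶ P)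
    (hs : s ≫ q = 𝟙 _) (y : Spec (.of O)) (a : Γ(Spec (.of O), ⊤)) :
    (s.stalkMap y).hom ((P.presheaf.Γgerm (s y)).hom (q.appTop.hom a)) = ((Spec (.of O)).presheaf.Γgerm y).hom a := by
  change (s.stalkMap y).hom ((P.presheaf.germ ⊤ (s y) trivial).hom (q.appTop.hom a)) =
    ((Spec (.of O)).presheaf.germ ⊤ y trivial).hom a
  rw [Scheme.Hom.germ_stalkMap_apply]
  change ((Spec (.of O)).presheaf.germ ⊤ y trivial).hom ((q.appTop ≫ s.appTop).hom a) = _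
  rw [← Scheme.Hom.comp_appTop, hs, Scheme.Hom.id_appTop]
  rfl

/-- **THE SECTION FRAME.** Let `O` be a DVR with uniformizer `ϖ`, `q : P → Spec O` separated, `s` a section, and assume
`R = 𝒪_{P,s(s₀)}` is a regular local ring. Then there are `c : Fin n → R` and `θ : R/(c) ≃+* O` with: `(c) = (ker s)_{s(s₀)}`,
`c` quasi-regular, `R/(c)` a domain, `θ(ϖ̄_R) = ϖ` for `ϖ_R` the germ of `q^*ϖ` (the `Γgerm ∘ appTop` spelling), `(c) + (ϖ_R) = 𝔪_R`,
and `ϖ_R ∉ (c)` — the complete stalk-local input of `exists_stalk_strictTransformIdeal_sup_comap` (p509910),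
`flat_carrierDelta_subschemeι_comp` (p512232) and `isRegular_carrierDelta_subscheme` (p513634), with `Λ = O`.
[cite: Matsumura1987, Thm. 14.2] -/
theorem exists_sectionFrame {P : Scheme.{0}} (q : P ⟶ Spec (.of O)) [IsSeparated q] (s : Spec (.of O) ⟶ P)
    (hs : s ≫ q = 𝟙 _) (hreg : IsRegularLocalRing (P.presheaf.stalk (s (IsLocalRing.closedPoint O))))
    (ϖ : O) (hϖ : Irreducible ϖ) :
    ∃ (n : ℕ) (c : Fin n → P.presheaf.stalk (s (IsLocalRing.closedPoint O)))
      (θ : (P.presheaf.stalk (s (IsLocalRing.closedPoint O)) ⧸ Ideal.span (Set.range c)) ≃+* O),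
      Ideal.span (Set.range c) = stalkIdeal s.ker (s (IsLocalRing.closedPoint O)) ∧ IsQuasiRegular c ∧
      IsDomain (P.presheaf.stalk (s (IsLocalRing.closedPoint O)) ⧸ Ideal.span (Set.range c)) ∧
      θ (Ideal.Quotient.mk _ ((P.presheaf.Γgerm (s (IsLocalRing.closedPoint O))).hom
        (q.appTop.hom ((Scheme.ΓSpecIso (.of O)).inv.hom ϖ)))) = ϖ ∧
      Ideal.span (Set.range c) ⊔ Ideal.span {(P.presheaf.Γgerm (s (IsLocalRing.closedPoint O))).hom
        (q.appTop.hom ((Scheme.ΓSpecIso (.of O)).inv.hom ϖ))} =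
        maximalIdeal (P.presheaf.stalk (s (IsLocalRing.closedPoint O))) ∧
      (P.presheaf.Γgerm (s (IsLocalRing.closedPoint O))).hom (q.appTop.hom ((Scheme.ΓSpecIso (.of O)).inv.hom ϖ)) ∉
        Ideal.span (Set.range c) := by
  classical
  haveI : IsClosedImmersion s := (section_isClosedImmersion_and_isRegular_ker O P q s hs).1
  haveI := hreg
  obtain ⟨eO, heO⟩ := exists_ringEquiv_stalk_closedPoint O
  -- `s^♯ : R → 𝒪_{Spec O, s₀}` is onto with kernel `(ker s)_{s(s₀)}`
  have hsurj : Function.Surjective (s.stalkMap (IsLocalRing.closedPoint O)).hom :=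
    s.stalkMap_surjective (IsLocalRing.closedPoint O)
  have hker : RingHom.ker (s.stalkMap (IsLocalRing.closedPoint O)).hom =
      stalkIdeal s.ker (s (IsLocalRing.closedPoint O)) :=
    (stalkIdeal_ker_eq_ker_stalkMap s (IsLocalRing.closedPoint O)).symm
  -- `s^♯(ϖ_R) = eO ϖ`
  have hϖ' : (s.stalkMap (IsLocalRing.closedPoint O)).hom ((P.presheaf.Γgerm (s (IsLocalRing.closedPoint O))).hom
      (q.appTop.hom ((Scheme.ΓSpecIso (.of O)).inv.hom ϖ))) = eO ϖ := by
    rw [stalkMap_section_Γgerm_appTop O q s hs, heO]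
    rfl
  -- `R/(ker s)_{s(s₀)} ≅ O`, hence regular
  let θ₀ : (P.presheaf.stalk (s (IsLocalRing.closedPoint O)) ⧸ stalkIdeal s.ker (s (IsLocalRing.closedPoint O))) ≃+* O :=
    ((Ideal.quotEquivOfEq hker.symm).trans (RingHom.quotientKerEquivOfSurjective hsurj)).trans eO.symm
  haveI : IsRegularLocalRing (P.presheaf.stalk (s (IsLocalRing.closedPoint O)) ⧸
      stalkIdeal s.ker (s (IsLocalRing.closedPoint O))) := IsRegularLocalRing.of_ringEquiv θ₀.symm
  have hI𝔪 : stalkIdeal s.ker (s (IsLocalRing.closedPoint O)) ≤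
      maximalIdeal (P.presheaf.stalk (s (IsLocalRing.closedPoint O))) := by
    rw [← hker]
    exact RingHom.ker_ne_top _ |> fun h => IsLocalRing.le_maximalIdeal h
  -- the ideal is generated by part of a regular system of parameters, which is quasi-regular
  obtain ⟨u, hu, S, hS⟩ := exists_rsop_of_isRegularLocalRing_quotient hI𝔪
  let T : Finset (Fin (maximalIdeal (P.presheaf.stalk (s (IsLocalRing.closedPoint O)))).spanFinrank) := S.toFinset
  let emb : Fin T.card → Fin (maximalIdeal (P.presheaf.stalk (s (IsLocalRing.closedPoint O)))).spanFinrank :=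
    fun i => (T.equivFin.symm i).1
  have hemb : Function.Injective emb := fun i j h => T.equivFin.symm.injective (Subtype.ext h)
  have hrange : Set.range emb = S := by
    ext k
    constructor
    · rintro ⟨i, rfl⟩
      exact Set.mem_toFinset.mp (T.equivFin.symm i).2
    · intro hk
      exact ⟨T.equivFin ⟨k, Set.mem_toFinset.mpr hk⟩, by simp [emb]⟩
  have hcI : Ideal.span (Set.range (u ∘ emb)) = stalkIdeal s.ker (s (IsLocalRing.closedPoint O)) := by
    rw [Set.range_comp, hrange, ← hS]
  have hqr : IsQuasiRegular (u ∘ emb) := isQuasiRegular_rsop_comp rfl u hu emb hemb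
  -- `θ : R/(c) ≅ O`
  let θ : (P.presheaf.stalk (s (IsLocalRing.closedPoint O)) ⧸ Ideal.span (Set.range (u ∘ emb))) ≃+* O :=
    (Ideal.quotEquivOfEq hcI).trans θ₀
  have hθ : θ (Ideal.Quotient.mk _ ((P.presheaf.Γgerm (s (IsLocalRing.closedPoint O))).hom
      (q.appTop.hom ((Scheme.ΓSpecIso (.of O)).inv.hom ϖ)))) = ϖ := by
    change eO.symm (RingHom.quotientKerEquivOfSurjective hsurj (Ideal.quotEquivOfEq hker.symm
      (Ideal.quotEquivOfEq hcI (Ideal.Quotient.mk _ _)))) = ϖ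
    rw [Ideal.quotEquivOfEq_mk, Ideal.quotEquivOfEq_mk, RingHom.quotientKerEquivOfSurjective_apply_mk, hϖ',
      RingEquiv.symm_apply_apply]
  -- `𝔪_R = (c) + (ϖ_R)`
  have h𝔪A : maximalIdeal ((Spec (.of O)).presheaf.stalk (IsLocalRing.closedPoint O)) = Ideal.span {eO ϖ} := by
    have h1 : (maximalIdeal O).comap (eO.symm : _ →+* O) =
        maximalIdeal ((Spec (.of O)).presheaf.stalk (IsLocalRing.closedPoint O)) := maximalIdeal_comap _
    rw [← h1, (IsDiscreteValuationRing.irreducible_iff_uniformizer ϖ).mp hϖ]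
    ext x
    rw [Ideal.mem_comap, Ideal.mem_span_singleton, Ideal.mem_span_singleton]
    constructor
    · rintro ⟨r, hr⟩
      refine ⟨eO r, eO.symm.injective ?_⟩
      rw [map_mul, RingEquiv.symm_apply_apply, RingEquiv.symm_apply_apply]
      exact hr
    · rintro ⟨r, hr⟩
      refine ⟨eO.symm r, ?_⟩
      change eO.symm x = _
      rw [hr, map_mul, RingEquiv.symm_apply_apply]
  have h𝔪 : Ideal.span (Set.range (u ∘ emb)) ⊔ Ideal.span {(P.presheaf.Γgerm (s (IsLocalRing.closedPoint O))).hom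
      (q.appTop.hom ((Scheme.ΓSpecIso (.of O)).inv.hom ϖ))} =
      maximalIdeal (P.presheaf.stalk (s (IsLocalRing.closedPoint O))) := by
    have h2 : (maximalIdeal ((Spec (.of O)).presheaf.stalk (IsLocalRing.closedPoint O))).comap
        (s.stalkMap (IsLocalRing.closedPoint O)).hom = maximalIdeal (P.presheaf.stalk (s (IsLocalRing.closedPoint O))) :=
      IsLocalRing.eq_maximalIdeal (Ideal.comap_isMaximal_of_surjective _ hsurj)
    refine Eq.trans ?_ h2
    rw [h𝔪A, ← hϖ', show Ideal.span {(s.stalkMap (IsLocalRing.closedPoint O)).hom ((P.presheaf.Γgerm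
        (s (IsLocalRing.closedPoint O))).hom (q.appTop.hom ((Scheme.ΓSpecIso (.of O)).inv.hom ϖ)))} =
        (Ideal.span {(P.presheaf.Γgerm (s (IsLocalRing.closedPoint O))).hom
          (q.appTop.hom ((Scheme.ΓSpecIso (.of O)).inv.hom ϖ))}).map (s.stalkMap (IsLocalRing.closedPoint O)).hom by
        rw [Ideal.map_span, Set.image_singleton],
      Ideal.comap_map_of_surjective _ hsurj, ← RingHom.ker_eq_comap_bot, hker, ← hcI, sup_comm]
  refine ⟨T.card, u ∘ emb, θ, hcI, hqr, MulEquiv.isDomain O θ.toMulEquiv, hθ, h𝔪, ?_⟩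
  -- `ϖ_R ∉ (c)`: its image `eO ϖ ≠ 0`
  rw [hcI, ← hker, RingHom.mem_ker, hϖ']
  exact fun h => hϖ.ne_zero (eO.injective (h.trans (map_zero eO).symm))

/-- **The section frame for given generators** `c` of `(ker s)_{s(s₀)}` with `dim 𝒪_{P,s(s₀)} = n + 1`: those `c` are
quasi-regular (`(c, ϖ_R)` is a regular system of parameters), `R/(c) ≃+* O` with `ϖ̄_R ↦ ϖ`, `R/(c)` a domain,
`(c) + (ϖ_R) = 𝔪_R`, `ϖ_R ∉ (c)`. [cite: Matsumura1987, Thm. 16.2] -/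
theorem exists_sectionFrame_of_span_eq {P : Scheme.{0}} (q : P ⟶ Spec (.of O)) [IsSeparated q] (s : Spec (.of O) ⟶ P)
    (hs : s ≫ q = 𝟙 _) (hreg : IsRegularLocalRing (P.presheaf.stalk (s (IsLocalRing.closedPoint O))))
    (ϖ : O) (hϖ : Irreducible ϖ) {n : ℕ} (c : Fin n → P.presheaf.stalk (s (IsLocalRing.closedPoint O)))
    (hcI : Ideal.span (Set.range c) = stalkIdeal s.ker (s (IsLocalRing.closedPoint O)))
    (hdim : ringKrullDim (P.presheaf.stalk (s (IsLocalRing.closedPoint O))) = (n + 1 : ℕ)) :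
    ∃ (θ : (P.presheaf.stalk (s (IsLocalRing.closedPoint O)) ⧸ Ideal.span (Set.range c)) ≃+* O),
      IsQuasiRegular c ∧ IsDomain (P.presheaf.stalk (s (IsLocalRing.closedPoint O)) ⧸ Ideal.span (Set.range c)) ∧
      θ (Ideal.Quotient.mk _ ((P.presheaf.Γgerm (s (IsLocalRing.closedPoint O))).hom
        (q.appTop.hom ((Scheme.ΓSpecIso (.of O)).inv.hom ϖ)))) = ϖ ∧
      Ideal.span (Set.range c) ⊔ Ideal.span {(P.presheaf.Γgerm (s (IsLocalRing.closedPoint O))).hom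
        (q.appTop.hom ((Scheme.ΓSpecIso (.of O)).inv.hom ϖ))} =
        maximalIdeal (P.presheaf.stalk (s (IsLocalRing.closedPoint O))) ∧
      (P.presheaf.Γgerm (s (IsLocalRing.closedPoint O))).hom (q.appTop.hom ((Scheme.ΓSpecIso (.of O)).inv.hom ϖ)) ∉
        Ideal.span (Set.range c) := by
  haveI : IsClosedImmersion s := (section_isClosedImmersion_and_isRegular_ker O P q s hs).1
  haveI := hreg
  obtain ⟨eO, heO⟩ := exists_ringEquiv_stalk_closedPoint O
  have hsurj : Function.Surjective (s.stalkMap (IsLocalRing.closedPoint O)).hom :=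
    s.stalkMap_surjective (IsLocalRing.closedPoint O)
  have hker : RingHom.ker (s.stalkMap (IsLocalRing.closedPoint O)).hom =
      stalkIdeal s.ker (s (IsLocalRing.closedPoint O)) :=
    (stalkIdeal_ker_eq_ker_stalkMap s (IsLocalRing.closedPoint O)).symm
  have hϖ' : (s.stalkMap (IsLocalRing.closedPoint O)).hom ((P.presheaf.Γgerm (s (IsLocalRing.closedPoint O))).hom
      (q.appTop.hom ((Scheme.ΓSpecIso (.of O)).inv.hom ϖ))) = eO ϖ := by
    rw [stalkMap_section_Γgerm_appTop O q s hs, heO]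
    rfl
  let θ : (P.presheaf.stalk (s (IsLocalRing.closedPoint O)) ⧸ Ideal.span (Set.range c)) ≃+* O :=
    ((Ideal.quotEquivOfEq (hcI.trans hker.symm)).trans (RingHom.quotientKerEquivOfSurjective hsurj)).trans eO.symm
  have hθ : θ (Ideal.Quotient.mk _ ((P.presheaf.Γgerm (s (IsLocalRing.closedPoint O))).hom
      (q.appTop.hom ((Scheme.ΓSpecIso (.of O)).inv.hom ϖ)))) = ϖ := by
    change eO.symm (RingHom.quotientKerEquivOfSurjective hsurj (Ideal.quotEquivOfEq (hcI.trans hker.symm)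
      (Ideal.Quotient.mk _ _))) = ϖ
    rw [Ideal.quotEquivOfEq_mk, RingHom.quotientKerEquivOfSurjective_apply_mk, hϖ', RingEquiv.symm_apply_apply]
  have h𝔪A : maximalIdeal ((Spec (.of O)).presheaf.stalk (IsLocalRing.closedPoint O)) = Ideal.span {eO ϖ} := by
    have h1 : (maximalIdeal O).comap (eO.symm : _ →+* O) =
        maximalIdeal ((Spec (.of O)).presheaf.stalk (IsLocalRing.closedPoint O)) := maximalIdeal_comap _
    rw [← h1, (IsDiscreteValuationRing.irreducible_iff_uniformizer ϖ).mp hϖ]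
    ext x
    rw [Ideal.mem_comap, Ideal.mem_span_singleton, Ideal.mem_span_singleton]
    constructor
    · rintro ⟨r, hr⟩
      refine ⟨eO r, eO.symm.injective ?_⟩
      rw [map_mul, RingEquiv.symm_apply_apply, RingEquiv.symm_apply_apply]
      exact hr
    · rintro ⟨r, hr⟩
      refine ⟨eO.symm r, ?_⟩
      change eO.symm x = _
      rw [hr, map_mul, RingEquiv.symm_apply_apply]
  have h𝔪 : Ideal.span (Set.range c) ⊔ Ideal.span {(P.presheaf.Γgerm (s (IsLocalRing.closedPoint O))).hom
      (q.appTop.hom ((Scheme.ΓSpecIso (.of O)).inv.hom ϖ))} =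
      maximalIdeal (P.presheaf.stalk (s (IsLocalRing.closedPoint O))) := by
    have h2 : (maximalIdeal ((Spec (.of O)).presheaf.stalk (IsLocalRing.closedPoint O))).comap
        (s.stalkMap (IsLocalRing.closedPoint O)).hom = maximalIdeal (P.presheaf.stalk (s (IsLocalRing.closedPoint O))) :=
      IsLocalRing.eq_maximalIdeal (Ideal.comap_isMaximal_of_surjective _ hsurj)
    refine Eq.trans ?_ h2
    rw [h𝔪A, ← hϖ', show Ideal.span {(s.stalkMap (IsLocalRing.closedPoint O)).hom ((P.presheaf.Γgerm
        (s (IsLocalRing.closedPoint O))).hom (q.appTop.hom ((Scheme.ΓSpecIso (.of O)).inv.hom ϖ)))} =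
        (Ideal.span {(P.presheaf.Γgerm (s (IsLocalRing.closedPoint O))).hom
          (q.appTop.hom ((Scheme.ΓSpecIso (.of O)).inv.hom ϖ))}).map (s.stalkMap (IsLocalRing.closedPoint O)).hom by
        rw [Ideal.map_span, Set.image_singleton],
      Ideal.comap_map_of_surjective _ hsurj, ← RingHom.ker_eq_comap_bot, hker, ← hcI, sup_comm]
  -- `(c, ϖ_R)` is a regular system of parameters, so `c` is quasi-regular
  have hrsop : IsRsopPart c := by
    refine ⟨hreg, 1, fun _ => (P.presheaf.Γgerm (s (IsLocalRing.closedPoint O))).hom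
      (q.appTop.hom ((Scheme.ΓSpecIso (.of O)).inv.hom ϖ)), hdim, ?_⟩
    rw [Ideal.span_union, Set.range_const]
    exact h𝔪
  refine ⟨θ, hrsop.isQuasiRegular, MulEquiv.isDomain O θ.toMulEquiv, hθ, h𝔪, ?_⟩
  rw [hcI, ← hker, RingHom.mem_ker, hϖ']
  exact fun h => hϖ.ne_zero (eO.injective (h.trans (map_zero eO).symm))

/-- **The section frame for given generators, with `θ` computed on every constant**: as
`exists_sectionFrame_of_span_eq`, and `θ` sends the class of the germ of `q^* b` to `b` for EVERY `b ∈ O`.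
[cite: Matsumura1987, Thm. 16.2] -/
theorem exists_sectionFrame_of_span_eq_forall {P : Scheme.{0}} (q : P ⟶ Spec (.of O)) [IsSeparated q]
    (s : Spec (.of O) ⟶ P) (hs : s ≫ q = 𝟙 _) (hreg : IsRegularLocalRing (P.presheaf.stalk (s (IsLocalRing.closedPoint O))))
    (ϖ : O) (hϖ : Irreducible ϖ) {n : ℕ} (c : Fin n → P.presheaf.stalk (s (IsLocalRing.closedPoint O)))
    (hcI : Ideal.span (Set.range c) = stalkIdeal s.ker (s (IsLocalRing.closedPoint O)))
    (hdim : ringKrullDim (P.presheaf.stalk (s (IsLocalRing.closedPoint O))) = (n + 1 : ℕ)) :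
    ∃ (θ : (P.presheaf.stalk (s (IsLocalRing.closedPoint O)) ⧸ Ideal.span (Set.range c)) ≃+* O),
      IsQuasiRegular c ∧ IsDomain (P.presheaf.stalk (s (IsLocalRing.closedPoint O)) ⧸ Ideal.span (Set.range c)) ∧
      (∀ b : O, θ (Ideal.Quotient.mk _ ((P.presheaf.Γgerm (s (IsLocalRing.closedPoint O))).hom
        (q.appTop.hom ((Scheme.ΓSpecIso (.of O)).inv.hom b)))) = b) ∧
      Ideal.span (Set.range c) ⊔ Ideal.span {(P.presheaf.Γgerm (s (IsLocalRing.closedPoint O))).hom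
        (q.appTop.hom ((Scheme.ΓSpecIso (.of O)).inv.hom ϖ))} =
        maximalIdeal (P.presheaf.stalk (s (IsLocalRing.closedPoint O))) ∧
      (P.presheaf.Γgerm (s (IsLocalRing.closedPoint O))).hom (q.appTop.hom ((Scheme.ΓSpecIso (.of O)).inv.hom ϖ)) ∉
        Ideal.span (Set.range c) := by
  haveI : IsClosedImmersion s := (section_isClosedImmersion_and_isRegular_ker O P q s hs).1
  haveI := hreg
  obtain ⟨eO, heO⟩ := exists_ringEquiv_stalk_closedPoint O
  have hsurj : Function.Surjective (s.stalkMap (IsLocalRing.closedPoint O)).hom :=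
    s.stalkMap_surjective (IsLocalRing.closedPoint O)
  have hker : RingHom.ker (s.stalkMap (IsLocalRing.closedPoint O)).hom =
      stalkIdeal s.ker (s (IsLocalRing.closedPoint O)) :=
    (stalkIdeal_ker_eq_ker_stalkMap s (IsLocalRing.closedPoint O)).symm
  have hb' : ∀ b : O, (s.stalkMap (IsLocalRing.closedPoint O)).hom ((P.presheaf.Γgerm (s (IsLocalRing.closedPoint O))).hom
      (q.appTop.hom ((Scheme.ΓSpecIso (.of O)).inv.hom b))) = eO b := fun b => by
    rw [stalkMap_section_Γgerm_appTop O q s hs, heO]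
    rfl
  let θ : (P.presheaf.stalk (s (IsLocalRing.closedPoint O)) ⧸ Ideal.span (Set.range c)) ≃+* O :=
    ((Ideal.quotEquivOfEq (hcI.trans hker.symm)).trans (RingHom.quotientKerEquivOfSurjective hsurj)).trans eO.symm
  have hθ : ∀ b : O, θ (Ideal.Quotient.mk _ ((P.presheaf.Γgerm (s (IsLocalRing.closedPoint O))).hom
      (q.appTop.hom ((Scheme.ΓSpecIso (.of O)).inv.hom b)))) = b := fun b => by
    change eO.symm (RingHom.quotientKerEquivOfSurjective hsurj (Ideal.quotEquivOfEq (hcI.trans hker.symm)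
      (Ideal.Quotient.mk _ _))) = b
    rw [Ideal.quotEquivOfEq_mk, RingHom.quotientKerEquivOfSurjective_apply_mk, hb', RingEquiv.symm_apply_apply]
  obtain ⟨θ', hqr, hdom, -, h𝔪, hϖc⟩ := exists_sectionFrame_of_span_eq O q s hs hreg ϖ hϖ c hcI hdim
  exact ⟨θ, hqr, hdom, hθ, h𝔪, hϖc⟩

/-- **THE SECTION FRAME, with `θ` on all constants** (rev 4): as `exists_sectionFrame`, and `θ` sends the class of the
germ of `q^* b` to `b` for every `b ∈ O` — so cone forms `map ι Φ₀`, `Φ₀ ∈ O[T]`, reduce under `θ ∘ mk` to `Φ₀`.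
[cite: Matsumura1987, Thm. 14.2] -/
theorem exists_sectionFrame_forall {P : Scheme.{0}} (q : P ⟶ Spec (.of O)) [IsSeparated q] (s : Spec (.of O) ⟶ P)
    (hs : s ≫ q = 𝟙 _) (hreg : IsRegularLocalRing (P.presheaf.stalk (s (IsLocalRing.closedPoint O))))
    (ϖ : O) (hϖ : Irreducible ϖ) :
    ∃ (n : ℕ) (c : Fin n → P.presheaf.stalk (s (IsLocalRing.closedPoint O)))
      (θ : (P.presheaf.stalk (s (IsLocalRing.closedPoint O)) ⧸ Ideal.span (Set.range c)) ≃+* O),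
      Ideal.span (Set.range c) = stalkIdeal s.ker (s (IsLocalRing.closedPoint O)) ∧ IsQuasiRegular c ∧
      IsDomain (P.presheaf.stalk (s (IsLocalRing.closedPoint O)) ⧸ Ideal.span (Set.range c)) ∧
      (∀ b : O, θ (Ideal.Quotient.mk _ ((P.presheaf.Γgerm (s (IsLocalRing.closedPoint O))).hom
        (q.appTop.hom ((Scheme.ΓSpecIso (.of O)).inv.hom b)))) = b) ∧
      Ideal.span (Set.range c) ⊔ Ideal.span {(P.presheaf.Γgerm (s (IsLocalRing.closedPoint O))).hom
        (q.appTop.hom ((Scheme.ΓSpecIso (.of O)).inv.hom ϖ))} =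
        maximalIdeal (P.presheaf.stalk (s (IsLocalRing.closedPoint O))) ∧
      (P.presheaf.Γgerm (s (IsLocalRing.closedPoint O))).hom (q.appTop.hom ((Scheme.ΓSpecIso (.of O)).inv.hom ϖ)) ∉
        Ideal.span (Set.range c) := by
  classical
  haveI : IsClosedImmersion s := (section_isClosedImmersion_and_isRegular_ker O P q s hs).1
  haveI := hreg
  obtain ⟨eO, heO⟩ := exists_ringEquiv_stalk_closedPoint O
  -- `s^♯ : R → 𝒪_{Spec O, s₀}` is onto with kernel `(ker s)_{s(s₀)}`
  have hsurj : Function.Surjective (s.stalkMap (IsLocalRing.closedPoint O)).hom :=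
    s.stalkMap_surjective (IsLocalRing.closedPoint O)
  have hker : RingHom.ker (s.stalkMap (IsLocalRing.closedPoint O)).hom =
      stalkIdeal s.ker (s (IsLocalRing.closedPoint O)) :=
    (stalkIdeal_ker_eq_ker_stalkMap s (IsLocalRing.closedPoint O)).symm
  have hb' : ∀ b : O, (s.stalkMap (IsLocalRing.closedPoint O)).hom ((P.presheaf.Γgerm (s (IsLocalRing.closedPoint O))).hom
      (q.appTop.hom ((Scheme.ΓSpecIso (.of O)).inv.hom b))) = eO b := fun b => by
    rw [stalkMap_section_Γgerm_appTop O q s hs, heO]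
    rfl
  have hϖ' : (s.stalkMap (IsLocalRing.closedPoint O)).hom ((P.presheaf.Γgerm (s (IsLocalRing.closedPoint O))).hom
      (q.appTop.hom ((Scheme.ΓSpecIso (.of O)).inv.hom ϖ))) = eO ϖ := by
    rw [stalkMap_section_Γgerm_appTop O q s hs, heO]
    rfl
  -- `R/(ker s)_{s(s₀)} ≅ O`, hence regular
  let θ₀ : (P.presheaf.stalk (s (IsLocalRing.closedPoint O)) ⧸ stalkIdeal s.ker (s (IsLocalRing.closedPoint O))) ≃+* O :=
    ((Ideal.quotEquivOfEq hker.symm).trans (RingHom.quotientKerEquivOfSurjective hsurj)).trans eO.symm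
  haveI : IsRegularLocalRing (P.presheaf.stalk (s (IsLocalRing.closedPoint O)) ⧸
      stalkIdeal s.ker (s (IsLocalRing.closedPoint O))) := IsRegularLocalRing.of_ringEquiv θ₀.symm
  -- `(ker s)_{s(s₀)} ⊆ 𝔪_R`
  have hI𝔪 : stalkIdeal s.ker (s (IsLocalRing.closedPoint O)) ≤
      maximalIdeal (P.presheaf.stalk (s (IsLocalRing.closedPoint O))) := by
    rw [← hker]
    exact RingHom.ker_ne_top _ |> fun h => IsLocalRing.le_maximalIdeal h
  -- the ideal is generated by part of a regular system of parameters, which is quasi-regular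
  obtain ⟨u, hu, S, hS⟩ := exists_rsop_of_isRegularLocalRing_quotient hI𝔪
  let T : Finset (Fin (maximalIdeal (P.presheaf.stalk (s (IsLocalRing.closedPoint O)))).spanFinrank) := S.toFinset
  let emb : Fin T.card → Fin (maximalIdeal (P.presheaf.stalk (s (IsLocalRing.closedPoint O)))).spanFinrank :=
    fun i => (T.equivFin.symm i).1
  have hemb : Function.Injective emb := fun i j h => T.equivFin.symm.injective (Subtype.ext h)
  have hrange : Set.range emb = S := by
    ext k
    constructor
    · rintro ⟨i, rfl⟩
      exact Set.mem_toFinset.mp (T.equivFin.symm i).2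
    · intro hk
      exact ⟨T.equivFin ⟨k, Set.mem_toFinset.mpr hk⟩, by simp [emb]⟩
  have hcI : Ideal.span (Set.range (u ∘ emb)) = stalkIdeal s.ker (s (IsLocalRing.closedPoint O)) := by
    rw [Set.range_comp, hrange, ← hS]
  have hqr : IsQuasiRegular (u ∘ emb) := isQuasiRegular_rsop_comp rfl u hu emb hemb
  -- `θ : R/(c) ≅ O`
  let θ : (P.presheaf.stalk (s (IsLocalRing.closedPoint O)) ⧸ Ideal.span (Set.range (u ∘ emb))) ≃+* O :=
    (Ideal.quotEquivOfEq hcI).trans θ₀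
  have hθ : ∀ b : O, θ (Ideal.Quotient.mk _ ((P.presheaf.Γgerm (s (IsLocalRing.closedPoint O))).hom
      (q.appTop.hom ((Scheme.ΓSpecIso (.of O)).inv.hom b)))) = b := fun b => by
    change eO.symm (RingHom.quotientKerEquivOfSurjective hsurj (Ideal.quotEquivOfEq hker.symm
      (Ideal.quotEquivOfEq hcI (Ideal.Quotient.mk _ _)))) = b
    rw [Ideal.quotEquivOfEq_mk, Ideal.quotEquivOfEq_mk, RingHom.quotientKerEquivOfSurjective_apply_mk, hb',
      RingEquiv.symm_apply_apply]
  -- `𝔪_R = (c) + (ϖ_R)`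
  have h𝔪A : maximalIdeal ((Spec (.of O)).presheaf.stalk (IsLocalRing.closedPoint O)) = Ideal.span {eO ϖ} := by
    have h1 : (maximalIdeal O).comap (eO.symm : _ →+* O) =
        maximalIdeal ((Spec (.of O)).presheaf.stalk (IsLocalRing.closedPoint O)) := maximalIdeal_comap _
    rw [← h1, (IsDiscreteValuationRing.irreducible_iff_uniformizer ϖ).mp hϖ]
    ext x
    rw [Ideal.mem_comap, Ideal.mem_span_singleton, Ideal.mem_span_singleton]
    constructor
    · rintro ⟨r, hr⟩
      refine ⟨eO r, eO.symm.injective ?_⟩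
      rw [map_mul, RingEquiv.symm_apply_apply, RingEquiv.symm_apply_apply]
      exact hr
    · rintro ⟨r, hr⟩
      refine ⟨eO.symm r, ?_⟩
      change eO.symm x = _
      rw [hr, map_mul, RingEquiv.symm_apply_apply]
  have h𝔪 : Ideal.span (Set.range (u ∘ emb)) ⊔ Ideal.span {(P.presheaf.Γgerm (s (IsLocalRing.closedPoint O))).hom
      (q.appTop.hom ((Scheme.ΓSpecIso (.of O)).inv.hom ϖ))} =
      maximalIdeal (P.presheaf.stalk (s (IsLocalRing.closedPoint O))) := by
    have h2 : (maximalIdeal ((Spec (.of O)).presheaf.stalk (IsLocalRing.closedPoint O))).comap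
        (s.stalkMap (IsLocalRing.closedPoint O)).hom = maximalIdeal (P.presheaf.stalk (s (IsLocalRing.closedPoint O))) :=
      IsLocalRing.eq_maximalIdeal (Ideal.comap_isMaximal_of_surjective _ hsurj)
    refine Eq.trans ?_ h2
    rw [h𝔪A, ← hϖ', show Ideal.span {(s.stalkMap (IsLocalRing.closedPoint O)).hom ((P.presheaf.Γgerm
        (s (IsLocalRing.closedPoint O))).hom (q.appTop.hom ((Scheme.ΓSpecIso (.of O)).inv.hom ϖ)))} =
        (Ideal.span {(P.presheaf.Γgerm (s (IsLocalRing.closedPoint O))).hom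
          (q.appTop.hom ((Scheme.ΓSpecIso (.of O)).inv.hom ϖ))}).map (s.stalkMap (IsLocalRing.closedPoint O)).hom by
        rw [Ideal.map_span, Set.image_singleton],
      Ideal.comap_map_of_surjective _ hsurj, ← RingHom.ker_eq_comap_bot, hker, ← hcI, sup_comm]
  refine ⟨T.card, u ∘ emb, θ, hcI, hqr, MulEquiv.isDomain O θ.toMulEquiv, hθ, h𝔪, ?_⟩
  -- `ϖ_R ∉ (c)`: its image `eO ϖ ≠ 0`
  rw [hcI, ← hker, RingHom.mem_ker, hϖ']
  exact fun h => hϖ.ne_zero (eO.injective (h.trans (map_zero eO).symm))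

end Summit.ResolutionOfSingularities.ResolutionOfSingularities.Cruxes.EquisingularLiftNat.Sections

end
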